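import Literature.AlgebraicGeometry.Motives.MixedHodgeStructureSplitOverQGraded
import Literature.AlgebraicGeometry.Motives.MixedHodgeStructureHodgeTateGradedPieces
import HarnessLib

/-!
# Split Hodge–Tate structures are sums of Tate structures: `H ≅ ⊕_p ℚ(-p)^{h^{p,p}}`

Marcolli, *Feynman motives*, after (2.49): a Hodge–Tate structure has `gr^W_{2p} M = ⊕ ℚ(-p)` and
`gr^W_{2p-1} M = 0`; the period matrix (2.50)–(2.51) measures the failure of `M` itself to be such a sum.
Goncharov, *Multiple polylogarithms and mixed Tate motives*, §3.1/§4.1: `gr^W_{2n} M` is a direct sum of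
copies of `ℚ(-n)`. Green–Griffiths–Kerr, §I.C (I.C.7) and footnote 3: the `ℚ`-split MHS are the direct sums
`⊕ Gr^W_i`. Carlson, *Extensions of mixed Hodge structures*, §2(b) Example: `ℚ(a)`, `ℚ(b)` are rigid and
an extension of Tate structures splits iff its class vanishes.

Combining `Motives/MixedHodgeStructureSplitOverQGraded` (a `ℚ`-split MHS is `⊕ₙ U_n` with `U_n ⥲ Gr^W_n`)
with `Motives/MixedHodgeStructureHodgeTateGradedPieces` (`Gr^W_{2p} ≅ ℚ(-p)^{h^{p,p}}` for Hodge–Tate `H`):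

* §1 Tate powers and their finite direct sums are Hodge–Tate AND split over `ℚ`
  (`isSplitOverQ_tatePow`, `isSplitOverQ_pi_tatePow`, `isHodgeTate_pi_tatePow`).
* §2 for a `ℚ`-split Hodge–Tate structure the odd weight pieces vanish and
  **`⊕_{p ∈ s} U_{2p} ⥲ H`** (`piEvenWeightPieceHom`, `…_bijective`).
* §3 **`H` is Hodge–Tate and split over `ℚ` iff `H ≅ ⊕_{p ∈ s} ℚ(-p)^{d_p}`** for some finite set `s` of
  integers and multiplicities `d_p` (`IsHodgeTate.exists_hom_pi_tatePow_bijective`,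
  `isHodgeTate_and_isSplitOverQ_iff`); the multiplicities are `d_p = dim Gr^W_{2p} = h^{p,p}`.

All statements proved; definitions with bodies; no named facts, no instances.

## References

* [Marcolli2009] M. Marcolli, Feynman motives (2010), after (2.49), (2.50)–(2.51) (held text p0088).
* [Goncharov2001MultiplePolylogarithms] A. B. Goncharov, Multiple polylogarithms and mixed Tate motives
  (2001), §3.1, §4.1.
* [GreenGriffithsKerr2012] M. Green, P. Griffiths, M. Kerr, Mumford–Tate groups and domains (2012), §I.C
  (I.C.7), footnote 3.
-/

noncomputable section

open scoped TensorProduct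
open Module

namespace Literature.AlgebraicGeometry.Motives

namespace MixedHodgeStructure

universe u

/-! ### §1 Tate powers and their sums -/

/-- **`ℚ(-m)^n` is split over `ℚ`** (its weight filtration has a single step). [cite: GreenGriffithsKerr2012, §I.C footnote 3] -/
theorem isSplitOverQ_tatePow (n : ℕ) (m : ℤ) : (tatePow n m).IsSplitOverQ :=
  isSplitOverQ_of_forall_W_eq_bot_or_eq_top fun k => by
    by_cases hk : k < 2 * m
    · exact Or.inl (tatePow_W_of_lt n hk)
    · exact Or.inr (tatePow_W_of_le n (not_lt.1 hk))

/-- **`⊕_{p ∈ s} ℚ(-p)^{d_p}` is split over `ℚ`.** [cite: GreenGriffithsKerr2012, §I.C (I.C.7)] -/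
theorem isSplitOverQ_pi_tatePow (s : Finset ℤ) (d : ℤ → ℕ) :
    (pi fun p : ↥s => tatePow (d p) p).IsSplitOverQ :=
  isSplitOverQ_pi fun p => isSplitOverQ_tatePow (d p) p

/-- **`⊕_{p ∈ s} ℚ(-p)^{d_p}` is Hodge–Tate.** [cite: Marcolli2009, (2.49)] -/
theorem isHodgeTate_pi_tatePow (s : Finset ℤ) (d : ℤ → ℕ) :
    (pi fun p : ↥s => tatePow (d p) p).IsHodgeTate :=
  (isHodgeTate_pi_iff _).2 fun p => isHodgeTate_tatePow (d p) p

/-! ### §2 The even weight pieces of a split Hodge–Tate structure -/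

variable {V : Type u} [AddCommGroup V] [Module ℚ V] {H : MixedHodgeStructure V}

namespace IsSplitOverQ

/-- For a Hodge–Tate structure the odd weight pieces vanish: `U_{2k+1} = 0`. [cite: Marcolli2009, (2.49)] -/
theorem weightForm_odd [FiniteDimensional ℚ V] (h : H.IsSplitOverQ) (ht : H.IsHodgeTate) (k : ℤ) :
    h.weightForm (2 * k + 1) = ⊥ :=
  eq_of_baseChange_eq (by rw [h.baseChange_weightForm, ht.deligneE_odd k, Submodule.baseChange_bot])

/-- For a Hodge–Tate structure `(U_{2p})_ℂ = I^{p,p}`. [cite: Marcolli2009, (2.49)] -/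
theorem baseChange_weightForm_two_mul [FiniteDimensional ℚ V] (h : H.IsSplitOverQ) (ht : H.IsHodgeTate) (p : ℤ) :
    (h.weightForm (2 * p)).baseChange ℂ = H.deligneI p p := by
  rw [h.baseChange_weightForm, ht.deligneE_two_mul p]

/-- `Σ_{p ∈ s} U_{2p} = V` when `s` carries all non-zero even pieces of a Hodge–Tate structure.
[cite: Marcolli2009, (2.49)] -/
theorem biSup_weightForm_two_mul_eq_top [FiniteDimensional ℚ V] (h : H.IsSplitOverQ) (ht : H.IsHodgeTate)
    {s : Finset ℤ} (hs : ∀ p, p ∉ s → h.weightForm (2 * p) = ⊥) : ⨆ p ∈ s, h.weightForm (2 * p) = ⊤ := by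
  rw [eq_top_iff, ← h.iSup_weightForm_eq_top]
  refine iSup_le fun n => ?_
  obtain ⟨k, rfl | rfl⟩ := Int.even_or_odd' n
  · by_cases hk : k ∈ s
    · exact le_iSup₂_of_le (f := fun p (_ : p ∈ s) => h.weightForm (2 * p)) k hk le_rfl
    · rw [hs k hk]
      exact bot_le
  · rw [h.weightForm_odd ht k]
    exact bot_le

/-- **The morphism `⊕_{p ∈ s} U_{2p} → H`.** [cite: GreenGriffithsKerr2012, §I.C (I.C.7)] -/
def piEvenWeightPieceHom (h : H.IsSplitOverQ) (s : Finset ℤ) :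
    Hom (pi fun p : ↥s => (h.weightPiece (2 * p)).toMixedHodgeStructure) H :=
  Hom.piDesc (fun p : ↥s => (h.weightPiece (2 * p)).toMixedHodgeStructure) fun p => (h.weightPiece (2 * (p : ℤ))).subtype

/-- `piEvenWeightPieceHom (u) = Σ_{p ∈ s} u_p`. [cite: GreenGriffithsKerr2012, §I.C (I.C.7)] -/
theorem piEvenWeightPieceHom_toLinearMap_apply (h : H.IsSplitOverQ) (s : Finset ℤ)
    (u : ∀ p : ↥s, ↥(h.weightForm (2 * p))) :
    (h.piEvenWeightPieceHom s).toLinearMap u = ∑ p : ↥s, (u p : V) :=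
  Hom.piDesc_toLinearMap_apply _ u

/-- `⊕_{p ∈ s} U_{2p} → H` is injective. [cite: GreenGriffithsKerr2012, §I.C (I.C.7)] -/
theorem piEvenWeightPieceHom_injective (h : H.IsSplitOverQ) (s : Finset ℤ) :
    Function.Injective (h.piEvenWeightPieceHom s).toLinearMap := by
  have hind : iSupIndep fun p : ↥s => h.weightForm (2 * p) :=
    h.iSupIndep_weightForm.comp (f := fun p : ↥s => 2 * (p : ℤ))
      (fun p q hpq => Subtype.ext (by simpa using hpq))
  rw [← LinearMap.ker_eq_bot, eq_bot_iff]
  intro u hu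
  rw [LinearMap.mem_ker, piEvenWeightPieceHom_toLinearMap_apply] at hu
  rw [Submodule.mem_bot]
  refine funext fun p => ?_
  have hsum : (u p : V) = -∑ q ∈ Finset.univ.erase p, (u q : V) := by
    rw [eq_neg_iff_add_eq_zero, Finset.add_sum_erase _ (fun q => (u q : V)) (Finset.mem_univ p)]
    exact hu
  have hmem : (u p : V) ∈ h.weightForm (2 * p) ⊓ ⨆ (q : ↥s) (_ : q ≠ p), h.weightForm (2 * q) := by
    refine ⟨(u p).2, ?_⟩
    rw [hsum]
    exact Submodule.neg_mem _ ((iSup₂_le fun q hq =>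
      le_iSup₂_of_le (f := fun (q : ↥s) (_ : q ≠ p) => h.weightForm (2 * (q : ℤ))) q (Finset.ne_of_mem_erase hq) le_rfl)
        (Submodule.sum_mem_biSup fun q _ => (u q).2))
  have h0 : (u p : V) = 0 := (Submodule.mem_bot ℚ).1 ((hind p).le_bot hmem)
  exact Submodule.coe_eq_zero.1 h0

/-- `⊕_{p ∈ s} U_{2p} → H` is surjective for a Hodge–Tate structure when `s` carries all non-zero even pieces.
[cite: Marcolli2009, (2.49)] -/
theorem piEvenWeightPieceHom_surjective [FiniteDimensional ℚ V] (h : H.IsSplitOverQ) (ht : H.IsHodgeTate)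
    {s : Finset ℤ} (hs : ∀ p, p ∉ s → h.weightForm (2 * p) = ⊥) :
    Function.Surjective (h.piEvenWeightPieceHom s).toLinearMap := by
  rw [← LinearMap.range_eq_top, eq_top_iff, ← h.biSup_weightForm_two_mul_eq_top ht hs]
  refine iSup₂_le fun p hp => ?_
  intro x hx
  refine ⟨Pi.single (⟨p, hp⟩ : ↥s) ⟨x, hx⟩, ?_⟩
  rw [piEvenWeightPieceHom_toLinearMap_apply, Finset.sum_eq_single (⟨p, hp⟩ : ↥s)
    (fun q _ hq => by rw [Pi.single_eq_of_ne hq]; rfl) (fun h' => absurd (Finset.mem_univ _) h'), Pi.single_eq_same]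

/-- **`⊕_{p ∈ s} U_{2p} ⥲ H`** for a `ℚ`-split Hodge–Tate structure. [cite: Marcolli2009, (2.49)] -/
theorem piEvenWeightPieceHom_bijective [FiniteDimensional ℚ V] (h : H.IsSplitOverQ) (ht : H.IsHodgeTate)
    {s : Finset ℤ} (hs : ∀ p, p ∉ s → h.weightForm (2 * p) = ⊥) :
    Function.Bijective (h.piEvenWeightPieceHom s).toLinearMap :=
  ⟨h.piEvenWeightPieceHom_injective s, h.piEvenWeightPieceHom_surjective ht hs⟩

/-- A finite set of integers `p` carrying all non-zero pieces `U_{2p}`. [cite: Marcolli2009, (2.49)] -/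
theorem exists_finset_weightForm_two_mul_eq_bot (h : H.IsSplitOverQ) :
    ∃ s : Finset ℤ, ∀ p, p ∉ s → h.weightForm (2 * p) = ⊥ := by
  obtain ⟨t, ht⟩ := h.exists_finset_weightForm_eq_bot
  refine ⟨t.image fun n => n / 2, fun p hp => ht (2 * p) fun h2p => hp ?_⟩
  exact Finset.mem_image.2 ⟨2 * p, h2p, by omega⟩

end IsSplitOverQ

/-! ### §3 `H` Hodge–Tate and `ℚ`-split `⟺ H ≅ ⊕_p ℚ(-p)^{d_p}` -/

/-- **A `ℚ`-split Hodge–Tate structure is a direct sum of Tate structures: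
`⊕_{p ∈ s} ℚ(-p)^{dim Gr^W_{2p} H} ⥲ H`** for every finite `s` carrying the non-zero pieces
(`U_{2p} ⥲ Gr^W_{2p} H ≅ ℚ(-p)^{h^{p,p}}`). [cite: Marcolli2009, (2.49)] -/
theorem IsHodgeTate.exists_hom_pi_tatePow_bijective_of_finset [FiniteDimensional ℚ V] (ht : H.IsHodgeTate)
    (h : H.IsSplitOverQ) {s : Finset ℤ} (hs : ∀ p, p ∉ s → h.weightForm (2 * p) = ⊥) :
    ∃ f : Hom (pi fun p : ↥s => tatePow (finrank ℚ (grW H.W (2 * p))) p) H, Function.Bijective f.toLinearMap := by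
  have hg := fun p : ↥s => ht.exists_hom_tatePow_gr_bijective (p : ℤ)
  choose g hg using hg
  refine ⟨(h.piEvenWeightPieceHom s).comp (Hom.piMap fun p : ↥s =>
    ((h.weightPieceGrHom (2 * p)).inverse (h.weightPieceGrHom_bijective (2 * p))).comp (g p)), ?_⟩
  rw [Hom.comp_toLinearMap, LinearMap.coe_comp]
  refine (h.piEvenWeightPieceHom_bijective ht hs).comp (Hom.piMap_bijective _ fun p => ?_)
  rw [Hom.comp_toLinearMap, LinearMap.coe_comp]
  exact (LinearEquiv.ofBijective _ (h.weightPieceGrHom_bijective (2 * (p : ℤ)))).symm.bijective.comp (hg p)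

/-- **A `ℚ`-split Hodge–Tate structure is isomorphic to `⊕_{p ∈ s} ℚ(-p)^{dim Gr^W_{2p} H}` for some finite `s`.**
[cite: Marcolli2009, (2.49)] -/
theorem IsHodgeTate.exists_hom_pi_tatePow_bijective [FiniteDimensional ℚ V] (ht : H.IsHodgeTate) (h : H.IsSplitOverQ) :
    ∃ (s : Finset ℤ) (f : Hom (pi fun p : ↥s => tatePow (finrank ℚ (grW H.W (2 * p))) p) H),
      Function.Bijective f.toLinearMap := by
  obtain ⟨s, hs⟩ := h.exists_finset_weightForm_two_mul_eq_bot
  obtain ⟨f, hf⟩ := ht.exists_hom_pi_tatePow_bijective_of_finset h hs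
  exact ⟨s, f, hf⟩

/-- **Conversely, anything isomorphic to a finite sum of Tate powers is Hodge–Tate and split over `ℚ`.**
[cite: GreenGriffithsKerr2012, §I.C (I.C.7)] -/
theorem isHodgeTate_and_isSplitOverQ_of_hom_pi_tatePow [FiniteDimensional ℚ V] {s : Finset ℤ} {d : ℤ → ℕ}
    (f : Hom (pi fun p : ↥s => tatePow (d p) p) H) (hf : Function.Bijective f.toLinearMap) :
    H.IsHodgeTate ∧ H.IsSplitOverQ :=
  ⟨(IsHodgeTate.of_bijective f hf).1 (isHodgeTate_pi_tatePow s d),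
    (isSplitOverQ_pi_tatePow s d).of_bijective f hf⟩

/-- **`H` is Hodge–Tate and split over `ℚ` iff `H ≅ ⊕_{p ∈ s} ℚ(-p)^{d_p}`** for some finite set `s` of integers
and multiplicities `d_p`. [cite: Marcolli2009, (2.49)] [cite: GreenGriffithsKerr2012, §I.C (I.C.7), footnote 3] -/
theorem isHodgeTate_and_isSplitOverQ_iff [FiniteDimensional ℚ V] :
    (H.IsHodgeTate ∧ H.IsSplitOverQ) ↔ ∃ (s : Finset ℤ) (d : ℤ → ℕ)
      (f : Hom (pi fun p : ↥s => tatePow (d p) p) H), Function.Bijective f.toLinearMap := by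
  constructor
  · rintro ⟨ht, h⟩
    obtain ⟨s, f, hf⟩ := ht.exists_hom_pi_tatePow_bijective h
    exact ⟨s, fun p => finrank ℚ (grW H.W (2 * p)), f, hf⟩
  · rintro ⟨s, d, f, hf⟩
    exact isHodgeTate_and_isSplitOverQ_of_hom_pi_tatePow f hf

/-- The multiplicities are forced: if `⊕_{p ∈ s} ℚ(-p)^{d_p} ≅ H` then `d_p = dim Gr^W_{2p} H = h^{p,p}` for
`p ∈ s`. [cite: Marcolli2009, (2.49)] -/
theorem eq_finrank_grW_of_hom_pi_tatePow [FiniteDimensional ℚ V] {s : Finset ℤ} {d : ℤ → ℕ}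
    (f : Hom (pi fun p : ↥s => tatePow (d p) p) H) (hf : Function.Bijective f.toLinearMap) (p : ↥s) :
    d p = finrank ℚ (grW H.W (2 * p)) := by
  -- `h^{p,p}` of the sum is `d_p` (the other summands have `h^{p,p} = 0`), Hodge numbers are invariant under
  -- isomorphisms, and `h^{p,p}(H) = dim Gr^W_{2p} H` for the Hodge–Tate structure `H`.
  have ht : H.IsHodgeTate := (isHodgeTate_and_isSplitOverQ_of_hom_pi_tatePow f hf).1
  have h1 : (pi fun q : ↥s => tatePow (d q) q).hodgeNumber p p = d p := by
    rw [hodgeNumber_pi, Finset.sum_eq_single p (fun q _ hq => hodgeNumber_tatePow_of_ne (d q)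
      (fun hpq => hq (Subtype.ext hpq.1.symm))) (fun h' => absurd (Finset.mem_univ _) h'), hodgeNumber_tatePow_self]
  rw [← h1, f.hodgeNumber_eq_of_bijective hf, ht.hodgeNumber_diag_eq_finrank_grW]

end MixedHodgeStructure

end Literature.AlgebraicGeometry.Motives
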